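import Summits.BirchSwinnertonDyer.Rank1Residual.X10.UnitRoadBSD
import Summits.BirchSwinnertonDyer.Rank1Residual.X10.UnitRoadPartnerRecordsA
import HarnessLib

/-!
# Class X10b (N2), the TRIVIAL-PARTNER road at `p = 3`: `BSD(E,3)` AT THE PAIR, records part A —
# 2 NON-unit N2 cells (408320p1, 413440h1), every one with `9 ∣ ∏ c_ℓ(E)`, from a congruent curve of TRIVIAL
# `3`-primary arithmetic whose Tamagawa binder is now a KERNEL certificate (cell `b2b-bsdres`, unit
# `b2b-bsdres-x10` = N2 class lead, gen 25)

HONEST FRAMING (run/shared/lean/b2b/bsd-rank1-residual/, verbatim in every file): the goal of the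
cell is to DELETE the COMBINATION-SHAPED residual classes of the Birch–Swinnerton-Dyer formula for
ALL analytic-rank `≤ 1` elliptic curves over `ℚ` — "full BSD formula for every rank `≤ 1` curve in
class `C`" assembled STRICTLY from published theorems — so that the rank-`≤ 1` remainder becomes
exactly the CONSTRUCTION-SHAPED classes, which are TYPED (missing-input `Prop`s), NOT attempted.
This is not "finishing BSD". Theorems only; NO definition, NO named fact; class X10b keeps its label
CONSTRUCTION-SHAPED (NEEDS X_A3, referee R82.3 / RESIDUAL-MAP §I N2); nothing is booked by this file;
everything is PER PAIR; no census number moves.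

## What (x10 GEN 25, X10-AUDIT §31)

x10 GEN 24's sibling file `X10/UnitRoadPartnerRecordsA.lean` recorded, for the same cells, X_A3 AT THE
PAIR (`MazurMainConjecture W 3`) by the TRIVIAL-PARTNER road: the partner `A` (`338d1`, `6845b1`, `13225a1`
or `256d1`) is good ordinary NON-anomalous at `3` with TRIVIAL `3`-primary arithmetic, x9 gen 5's
`mazurMainConjecture_with_mu_zero_of_trivialArithmetic_odd` (Kato 2004 Thm. 17.4 (1) `hkato`, Greenberg
1999 Thm. 4.1 `hGr`, period unit `h5`/`h3`) gives Mazur's main conjecture for `A` trivially, and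
Greenberg–Vatsal 2000 Thm. (1.4) (`hGV`) transports it along the kernel Hesse certificate C1
(`torsionIso_p<A>_u<E>`, Fisher 2012). THIS file records the CONSEQUENCE `BSDp W 3` (Miller's `BSD(E,3)`):
* analytic rank `0` (`hr0`): `UnitRoad.bsdp_three_of_ainvs_of_trivialPartner_rankZero` = the road ∘
  `Rank1Residual.bsdp_of_mazurMainConjecture_of_analyticRank_eq_zero` (Greenberg LNM 1716 Thm. 4.1 via
  Castella–Grossi–Lee–Skinner's deduction; modularity `hmod`; Gross–Zagier–Kolyvagin `hGZK`) — NO descent,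
  NO `L`-value, NO Tamagawa datum OF THE TARGET is used: Greenberg's Euler characteristic carries
  `#Ш(E)[3^∞]` and `∏ c_ℓ(E)` together, although `9 ∣ ∏ c_ℓ(E)` on every target (a route independent of
  the lane's `3`-descent line for these cells);
* analytic rank `1` (`hr1`): `UnitRoad.bsdp_three_of_ainvs_of_trivialPartner_rankOne_of_schneider` = the road ∘
  `Rank1Residual.bsdp_of_mazurMainConjecture_of_analyticRank_eq_one_of_schneider_odd` (Perrin-Riou–Schneider
  leading terms `hS`, Perrin-Riou's `3`-adic Gross–Zagier `hPR`, Mazur–Tate `σ` `hMT`; MODULO the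
  per-curve Schneider certificate `hSch` of the canonical `3`-adic height, displayed not discharged).
The partner's Tamagawa binder `htamA` of GEN 24 is DISCHARGED here by the kernel Tate-algorithm
certificate `UnitRoad.not_three_dvd_tamagawaProduct_p<A>` (`∏ c_ℓ(A)` = `2 / 4 / 4 / 2`,
`X10/UnitRoadBSD.lean` §0). DISPLAYED binders left: PUBLISHED `hkato`, `hGr`, `h5`, `h3`, `hGV`, `hmod`,
`hGZK` (+ `hS`, `hPR`, `hMT` in rank one); CENSUS (Cremona `allbsd` row of the PARTNER) `hLA`, `hSelA`;
`hr0` / `hr1` (analytic rank of the target, Cremona); `hSch` (rank one). Data `HOME/b2b-bsdres-x10/g24/gen/`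
(unchanged) + `g25/gen/mkbsd.py`. Per pair; class statement untouched; nothing booked.

References: R. Greenberg, V. Vatsal, Invent. Math. 142 (2000) Thm. (1.4) [GreenbergVatsal2000]; K.
Kato, Astérisque 295 (2004) Thm. 17.4 (1) [Kato2004Asterisque]; R. Greenberg, LNM 1716 (1999) Thm. 4.1
[GreenbergLNM1716]; F. Castella, G. Grossi, J. Lee, C. Skinner, Invent. Math. 227 (2022) Thm. 5.1.4
[CastellaEtAl2021]; B. Perrin-Riou, Invent. Math. 89 (1987) §1.4 [PerrinRiou1987]; J. Balakrishnan,
J. S. Müller, W. Stein, Math. Comp. 85 (2016) Thm. 1.7 [BalakrishnanMullerStein2015]; B. Mazur, J. Tate,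
Duke Math. J. 62 (1991) [MazurTate1991]; T. Fisher, Proc. LMS 104 (2012) Thm. 13.2, §13 [Fisher2012Hessian];
R. L. Miller, LMS J. Comput. Math. 14 (2011) Def. 1.1 [Miller2011LMS]; J. H. Silverman, GTM 151 (1994)
IV.9.4 [Silverman1994]; J. E. Cremona, tables [Cremona2006].
-/

set_option autoImplicit false

noncomputable section

open scoped Classical MatrixGroups ModularForm

open CongruenceSubgroup WeierstrassCurve Literature.NumberTheory.EllipticCurves
  Literature.NumberTheory.EllipticCurves.ModularForms Literature.NumberTheory.EllipticCurves.Rank1Residual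
  Literature.NumberTheory.EllipticCurves.Rank1Residual.X11RankOneCertificates
  Summit.BirchSwinnertonDyer.BirchSwinnertonDyer.Rank1Residual.IntModel
  Summit.BirchSwinnertonDyer.BirchSwinnertonDyer.Rank1Residual.X11RankOne
  Summit.BirchSwinnertonDyer.BirchSwinnertonDyer.Theorems.Rank1ResidualX1Defs

namespace Summit.BirchSwinnertonDyer.Rank1Residual.X10.UnitRoad

open Summit.BirchSwinnertonDyer.Rank1Residual.X10.CMPartnerRecords
  Summit.BirchSwinnertonDyer.Rank1Residual.X10.CMPartnerCurves
  Summit.BirchSwinnertonDyer.Rank1Residual.X10.CMPartnerKernel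

/-! ### `408320p1` (3Ns, N = 408320, r_an = 0, ∏ c_ℓ = 18) ← `256d1` -/

/-- **`BSD(E,3)` AT THE PAIR `(408320p1, 3)` by the TRIVIAL-PARTNER road: `BSDp W 3`** — analytic rank `0`, NO
descent / `L`-value / Tamagawa datum of the target used. Target `408320p1 = [0, -1, 0, 1365, -67033]` (`N = 408320 = 2^8 · 5 · 11 · 29`, census
image `3Ns`; Cremona `allbsd`: analytic rank `0` (`hr0`), `#E(ℚ)_tors = 1`, `∏ c_ℓ = 18` (`ord₃ = 2`), `#Ш_an = 1` — so the
recorded `BSD(E,3)` says `ord₃ (L(E,1)/Ω_E) = ord₃ (#Ш(E)·∏ c_ℓ / #E(ℚ)²_tors)`, `= 2` on Cremona's data; `#Ẽ(𝔽₃) = 2`,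
`a₃ = 2`; Frobenius witness `ℓ = 7`, `#Ẽ(𝔽_{7}) = 5`); partner `A = 256d1 = [0, -1, 0, -3, -1]` (`N_A = 256 = 2⁸`; Cremona: rank
`0`, `#A(ℚ)_tors = 2`, `#Ш_an = 1`, `L/Ω = 1/2`; `∏ c_ℓ(A) = 2` IN THE KERNEL (`tamagawaProduct_p256d1`); `#Ã(𝔽₃) = 2`:
good ordinary NON-anomalous); C1 = `torsionIso_cm256d1_t408320p1` (x10 GEN 23, kernel Hesse certificate). Displayed binders:
PUBLISHED `hkato`, `hGr`, `h5`, `h3`, `hGV`, `hmod`, `hGZK`; census `hLA`, `hSelA` (the PARTNER's row), `hr0`.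
Per pair; class statement untouched; nothing booked. [cite: GreenbergVatsal2000, Thm. (1.4) (arXiv p. 5)]
[cite: Kato2004Asterisque, Thm. 17.4 (1) (p. 273)] [cite: GreenbergLNM1716, Thm. 4.1 (p. 102)]
[cite: CastellaEtAl2021, Thm. 5.1.4 (proof, §5.1.3)] [cite: Miller2011LMS, Def. 1.1]
[cite: Fisher2012Hessian, Thm. 13.2 and §13] [cite: Cremona2006, Table 1 (Cremona labels 408320p1, 256d1)] -/
theorem bsdp_partner_u408320p1
    (hkato : ∀ (W : WeierstrassCurve ℚ) [W.IsElliptic] [W.IsGloballyMinimal] (p : ℕ) [Fact p.Prime]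
      (κ : ZpExtension ℚ p) (γ : Field.absoluteGaloisGroup ℚ) (N : ℕ) [NeZero N]
      (f : CuspForm (Gamma0 N) 2), kato_divisibility W p (κ := κ) (γ := γ) (f := f))
    (hGr : greenberg_charValue_rankZero) (h5 : realPeriodRat_eq_unit_mul_plusPeriod)
    (h3 : realPeriodRat_eq_unit_mul_plusPeriod_three)
    (hGV : GreenbergVatsal2000.thm14_mainConjecture_transfer_of_torsionIso)
    (hmod : nonempty_modularParametrizationData)
    (hGZK : rank_eq_analyticRank_of_analyticRank_le_one)
    (W A : WeierstrassCurve ℚ) [W.IsElliptic] [W.IsGloballyMinimal] [A.IsElliptic] [A.IsGloballyMinimal]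
    [Fact (Nat.Prime 3)]
    (hW : W = ⟨0, (-1), 0, 1365, (-67033)⟩) (hA : A = ⟨0, (-1), 0, (-3), (-1)⟩)
    (hLA : ∃ q : ℚ, q ≠ 0 ∧ A.entireLFunction 1 / (A.realPeriodRat : ℂ) = (q : ℂ) ∧ padicValRat 3 q = 0)
    (hSelA : Nat.card (A.selmerGroupPInfty 3) = 1)
    (hr0 : W.analyticRank = 0) :
    BSDp W 3 := by
  have hIW : integralModelInt W = ⟨0, (-1), 0, 1365, (-67033)⟩ :=
    integralModelInt_eq_of_map_eq _ (by rw [hW]; ext <;> simp [WeierstrassCurve.map])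
  have hIA : integralModelInt A = ⟨0, (-1), 0, (-3), (-1)⟩ :=
    integralModelInt_eq_of_map_eq _ (by rw [hA]; ext <;> simp [WeierstrassCurve.map])
  haveI : Fact (Nat.Prime 7) := ⟨by norm_num⟩
  exact bsdp_three_of_ainvs_of_trivialPartner_rankZero hkato hGr h5 h3 hGV hmod hGZK
    0 (-1) 0 1365 (-67033) hIW 0 (-1) 0 (-3) (-1) hIA 7 5 2 2
    (by decide +kernel) card_t408320p1_3 (by decide) (by decide) (by decide +kernel) card_t408320p1_7
    (by decide +kernel) (by decide +kernel) card_cm256d1_3 (by decide) (by decide)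
    (not_three_dvd_tamagawaProduct_p256d1 hIA) hLA hSelA (torsionIso_cm256d1_t408320p1 W A hW hA) hr0

/-! ### `413440h1` (3Ns, N = 413440, r_an = 1, ∏ c_ℓ = 54) ← `256d1` -/

/-- **`BSD(E,3)` AT THE PAIR `(413440h1, 3)` — an N2 cell of ANALYTIC RANK ONE — by the TRIVIAL-PARTNER road,
MODULO the Schneider certificate: `BSDp W 3`.** Target `413440h1 = [0, -1, 0, -5645, -586475]` (`N = 413440 = 2^8 · 5 · 17 · 19`, census image
`3Ns`; Cremona `allbsd`: analytic rank `1` (`hr1`), `#E(ℚ)_tors = 1`, `∏ c_ℓ = 54` (`ord₃ = 3`), `#Ш_an = 1` — so the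
recorded `BSD(E,3)` says `ord₃ (L'(E,1)/(Ω_E·Reg_E)) = ord₃ (#Ш(E)·∏ c_ℓ / #E(ℚ)²_tors)`, `= 3` on Cremona's data;
`#Ẽ(𝔽₃) = 5`, `a₃ = -1`; Frobenius witness `ℓ = 7`, `#Ẽ(𝔽_{7}) = 8`); partner `A = 256d1 = [0, -1, 0, -3, -1]`
(`N_A = 256 = 2⁸`; Cremona: rank `0`, `#A(ℚ)_tors = 2`, `#Ш_an = 1`, `L/Ω = 1/2`; `∏ c_ℓ(A) = 2` IN THE KERNEL
(`tamagawaProduct_p256d1`); `#Ã(𝔽₃) = 2`: good ordinary NON-anomalous); C1 = `torsionIso_cm256d1_t413440h1` (x10 GEN 23, kernel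
Hesse certificate). Displayed binders: PUBLISHED `hkato`, `hGr`, `h5`, `h3`, `hGV`, `hS`, `hPR`, `hMT`, `hmod`,
`hGZK`; census `hLA`, `hSelA` (the PARTNER's row), `hr1`; the CERTIFICATE `hSch` (non-degeneracy of the
canonical cyclotomic `3`-adic height of `E` — a `3`-adic computation per curve, NOT supplied here). Per pair;
class statement untouched; nothing booked. [cite: GreenbergVatsal2000, Thm. (1.4) (arXiv p. 5)]
[cite: Kato2004Asterisque, Thm. 17.4 (1) (p. 273)] [cite: PerrinRiou1987, §1.4 Cor. 1.8]
[cite: BalakrishnanMullerStein2015, Thm. 1.7] [cite: MazurTate1991, Thm. 3.1] [cite: Miller2011LMS, Def. 1.1]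
[cite: Fisher2012Hessian, Thm. 13.2 and §13] [cite: Cremona2006, Table 1 (Cremona labels 413440h1, 256d1)] -/
theorem bsdp_partner_u413440h1
    (hkato : ∀ (W : WeierstrassCurve ℚ) [W.IsElliptic] [W.IsGloballyMinimal] (p : ℕ) [Fact p.Prime]
      (κ : ZpExtension ℚ p) (γ : Field.absoluteGaloisGroup ℚ) (N : ℕ) [NeZero N]
      (f : CuspForm (Gamma0 N) 2), kato_divisibility W p (κ := κ) (γ := γ) (f := f))
    (hGr : greenberg_charValue_rankZero) (h5 : realPeriodRat_eq_unit_mul_plusPeriod)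
    (h3 : realPeriodRat_eq_unit_mul_plusPeriod_three)
    (hGV : GreenbergVatsal2000.thm14_mainConjecture_transfer_of_torsionIso)
    (hS : Schneider1985_order_charGenerator_odd) (hPR : perrinRiou_rankOne_leadingTerms_odd)
    (hMT : mazur_tate_sigma_exists_odd)
    (hmod : nonempty_modularParametrizationData)
    (hGZK : rank_eq_analyticRank_of_analyticRank_le_one)
    (W A : WeierstrassCurve ℚ) [W.IsElliptic] [W.IsGloballyMinimal] [A.IsElliptic] [A.IsGloballyMinimal]
    [Fact (Nat.Prime 3)]
    (hW : W = ⟨0, (-1), 0, (-5645), (-586475)⟩) (hA : A = ⟨0, (-1), 0, (-3), (-1)⟩)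
    (hLA : ∃ q : ℚ, q ≠ 0 ∧ A.entireLFunction 1 / (A.realPeriodRat : ℂ) = (q : ℂ) ∧ padicValRat 3 q = 0)
    (hSelA : Nat.card (A.selmerGroupPInfty 3) = 1)
    (hr1 : W.analyticRank = 1)
    (hSch : ∀ Dh : PAdicHeightData W 3, Dh.IsCanonical → SchneiderConjecture Dh) :
    BSDp W 3 := by
  have hIW : integralModelInt W = ⟨0, (-1), 0, (-5645), (-586475)⟩ :=
    integralModelInt_eq_of_map_eq _ (by rw [hW]; ext <;> simp [WeierstrassCurve.map])
  have hIA : integralModelInt A = ⟨0, (-1), 0, (-3), (-1)⟩ :=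
    integralModelInt_eq_of_map_eq _ (by rw [hA]; ext <;> simp [WeierstrassCurve.map])
  haveI : Fact (Nat.Prime 7) := ⟨by norm_num⟩
  exact bsdp_three_of_ainvs_of_trivialPartner_rankOne_of_schneider hkato hGr h5 h3 hGV hS hPR hMT hmod hGZK
    0 (-1) 0 (-5645) (-586475) hIW 0 (-1) 0 (-3) (-1) hIA 7 8 5 2
    (by decide +kernel) card_t413440h1_3 (by decide) (by decide) (by decide +kernel) card_t413440h1_7
    (by decide +kernel) (by decide +kernel) card_cm256d1_3 (by decide) (by decide)
    (not_three_dvd_tamagawaProduct_p256d1 hIA) hLA hSelA (torsionIso_cm256d1_t413440h1 W A hW hA) hr1 hSch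

end Summit.BirchSwinnertonDyer.Rank1Residual.X10.UnitRoad

end
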